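import Mathlib
import Summits.Ventures.PercRepro2.Defs
import Summits.Ventures.PercRepro2.Graph
import Summits.Ventures.PercRepro2.OneColourSwitch
import Summits.Ventures.PercRepro2.RegionHubSign
import Summits.Ventures.PercRepro2.TermSwitchDefs

/-!
# Connection transfer between graphs differing on loops, one edge, or the edges inside a terminal
set (blind cell PercRepro2, p3 g24, 2026-08-28; `proofs/P3-CONJG.md` §4)

Three transfer lemmas for the `T`-edge identity of Conjecture G: (1) two (graph, colouring)
pairs whose open non-loop edges agree have the same connections (`conn_of_open_agree`);
(2) restoring one open edge `{x, y}` in place of a loop joins exactly the pairs that were joined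
through `x` and `y` (`conn_update_edge_iff`); (3) the two-colour worlds of a terminal set `H` and
the `p`–`q` connections of a colouring separated from `H` do not see the edges inside `H`
(`KH_eq_of_agree_off`, `conn_pq_of_agree_off`, `sigma_pq_eq_of_agree_off`).  Own work; std axioms.
-/

namespace Summit.Ventures.PercRepro2

namespace NoPocket

open Finset Classical RegionHub OneColourSwitch TermSwitch

variable {V : Type*} {E : Type*}

section Agree

/-- **Open-edge agreement transfers connections**: if every open non-loop edge of `(ends, ω)` is
an open edge of `(ends', ω')` with the same ends, connections of `(ends, ω)` are connections of
`(ends', ω')`. -/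
lemma conn_of_open_agree {ends ends' : E → Sym2 V} {ω ω' : Config E}
    (h : ∀ e, ω e = true → ¬ (ends e).IsDiag → ends' e = ends e ∧ ω' e = true) {u v : V}
    (hc : Conn ends ω u v) : Conn ends' ω' u v := by
  refine mem_of_conn_of_closed (S := {w | Conn ends' ω' u w}) ?_ (conn_refl _ _ _) hc
  intro x hx y hxy
  obtain ⟨hne, e, he, hends⟩ := openGraph_adj.1 hxy
  have hnd : ¬ (ends e).IsDiag := by
    rw [hends, Sym2.mk_isDiag_iff]
    exact hne
  obtain ⟨h1, h2⟩ := h e he hnd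
  exact conn_trans hx (conn_of_openAdj ⟨e, h2, by rw [h1, hends]⟩)

/-- **Restoring one open edge.** With `ends e₀` a loop and `e₀` open, the graph with `e₀` given
the ends `{x, y}` joins `u` to `v` iff `ends` does, or `ends` joins `u` to one end and the other
end to `v`. -/
lemma conn_update_edge_iff [DecidableEq E] {ends : E → Sym2 V} {e₀ : E} (hd : (ends e₀).IsDiag)
    {x y : V} {ω : Config E} (hω : ω e₀ = true) {u v : V} :
    Conn (Function.update ends e₀ s(x, y)) ω u v ↔
      Conn ends ω u v ∨ (Conn ends ω u x ∧ Conn ends ω y v) ∨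
        (Conn ends ω u y ∧ Conn ends ω x v) := by
  constructor
  · intro h
    refine mem_of_conn_of_closed (S := {w | Conn ends ω u w ∨ (Conn ends ω u x ∧ Conn ends ω y w) ∨
      (Conn ends ω u y ∧ Conn ends ω x w)}) ?_ (Or.inl (conn_refl _ _ _)) h
    intro w₁ hw₁ w₂ hw
    obtain ⟨hne, e, he, hends⟩ := openGraph_adj.1 hw
    by_cases hee : e = e₀
    · subst hee
      rw [Function.update_self] at hends
      rcases Sym2.eq_iff.1 hends with ⟨rfl, rfl⟩ | ⟨rfl, rfl⟩
      · -- the edge runs from `x` to `y`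
        rcases hw₁ with h1 | ⟨h1, _⟩ | ⟨h1, _⟩
        · exact Or.inr (Or.inl ⟨h1, conn_refl _ _ _⟩)
        · exact Or.inr (Or.inl ⟨h1, conn_refl _ _ _⟩)
        · exact Or.inl h1
      · -- the edge runs from `y` to `x`
        rcases hw₁ with h1 | ⟨h1, _⟩ | ⟨h1, _⟩
        · exact Or.inr (Or.inr ⟨h1, conn_refl _ _ _⟩)
        · exact Or.inl h1
        · exact Or.inr (Or.inr ⟨h1, conn_refl _ _ _⟩)
    · rw [Function.update_of_ne hee] at hends
      have hc : Conn ends ω w₁ w₂ := conn_of_openAdj ⟨e, he, hends⟩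
      rcases hw₁ with h1 | ⟨h1, h2⟩ | ⟨h1, h2⟩
      · exact Or.inl (conn_trans h1 hc)
      · exact Or.inr (Or.inl ⟨h1, conn_trans h2 hc⟩)
      · exact Or.inr (Or.inr ⟨h1, conn_trans h2 hc⟩)
  · have hup : ∀ {a b : V}, Conn ends ω a b → Conn (Function.update ends e₀ s(x, y)) ω a b := by
      intro a b hab
      refine conn_of_open_agree (fun e he hnd => ⟨?_, he⟩) hab
      have hee : e ≠ e₀ := by
        rintro rfl
        exact hnd hd
      rw [Function.update_of_ne hee]
    have hxy : Conn (Function.update ends e₀ s(x, y)) ω x y :=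
      conn_of_openAdj ⟨e₀, hω, Function.update_self _ _ _⟩
    rintro (h | ⟨h1, h2⟩ | ⟨h1, h2⟩)
    · exact hup h
    · exact conn_trans (hup h1) (conn_trans hxy (hup h2))
    · exact conn_trans (hup h1) (conn_trans (conn_symm hxy) (hup h2))

end Agree

section Terminal

/-- The agreement of two (graph, colouring) pairs off the edges inside the terminal set `H`:
every edge either has all its ends in `H` (in `ends`) or keeps its ends and its colour. -/
def AgreeOff (ends ends' : E → Sym2 V) (H : Set V) (ω ω' : Config E) : Prop :=
  ∀ e, (∀ z ∈ ends e, z ∈ H) ∨ (ends' e = ends e ∧ ω' e = ω e)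

/-- The agreement is symmetric once both graphs keep their `H`-internal edges inside `H`. -/
lemma AgreeOff.symm {ends ends' : E → Sym2 V} {H : Set V} {ω ω' : Config E}
    (h : AgreeOff ends ends' H ω ω')
    (hH : ∀ e, (∀ z ∈ ends e, z ∈ H) → (∀ z ∈ ends' e, z ∈ H)) :
    AgreeOff ends' ends H ω' ω := by
  intro e
  rcases h e with h1 | ⟨h1, h2⟩
  · exact Or.inl (hH e h1)
  · exact Or.inr ⟨h1.symm, h2.symm⟩

/-- The agreement passes to the flipped colourings. -/
lemma AgreeOff.compl {ends ends' : E → Sym2 V} {H : Set V} {ω ω' : Config E}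
    (h : AgreeOff ends ends' H ω ω') :
    AgreeOff ends ends' H (OneColourSwitch.compl ω) (OneColourSwitch.compl ω') := by
  intro e
  rcases h e with h1 | ⟨h1, h2⟩
  · exact Or.inl h1
  · exact Or.inr ⟨h1, by simp [OneColourSwitch.compl, h2]⟩

/-- **The `Y`-world of `H` does not see the edges inside `H`** (one inclusion). -/
lemma KH_subset_of_agree_off {ends ends' : E → Sym2 V} {H : Set V} {ω ω' : Config E}
    (h : AgreeOff ends ends' H ω ω') : KH ends H ω ⊆ KH ends' H ω' := by
  intro x hx
  obtain ⟨h₀, hh₀, hc⟩ := mem_KH_iff.1 hx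
  have key : x ∈ {w | w ∈ H ∨ w ∈ KH ends' H ω'} := by
    refine mem_of_conn_of_closed (S := {w | w ∈ H ∨ w ∈ KH ends' H ω'}) ?_ (Or.inl hh₀) hc
    intro w₁ hw₁ w₂ hw
    obtain ⟨_, e, he, hends⟩ := openGraph_adj.1 hw
    rcases h e with h1 | ⟨h1, h2⟩
    · exact Or.inl (h1 w₂ (by rw [hends]; exact Sym2.mem_mk_right _ _))
    · rcases hw₁ with hw₁ | hw₁
      · exact Or.inr ⟨w₁, hw₁, conn_of_openAdj ⟨e, by rw [h2]; exact he, by rw [h1, hends]⟩⟩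
      · exact Or.inr (mem_KH_of_open hw₁ (by rw [h2]; exact he) (by rw [h1, hends]))
  rcases key with hx' | hx'
  · exact mem_KH_of_mem hx' ω'
  · exact hx'

/-- **The `Y`-world of `H` does not see the edges inside `H`.** -/
lemma KH_eq_of_agree_off {ends ends' : E → Sym2 V} {H : Set V} {ω ω' : Config E}
    (h : AgreeOff ends ends' H ω ω')
    (hH : ∀ e, (∀ z ∈ ends e, z ∈ H) → (∀ z ∈ ends' e, z ∈ H)) :
    KH ends H ω = KH ends' H ω' :=
  Set.Subset.antisymm (KH_subset_of_agree_off h) (KH_subset_of_agree_off (h.symm hH))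

/-- **The `W`-world of `H` does not see the edges inside `H`.** -/
lemma MH_eq_of_agree_off {ends ends' : E → Sym2 V} {H : Set V} {ω ω' : Config E}
    (h : AgreeOff ends ends' H ω ω')
    (hH : ∀ e, (∀ z ∈ ends e, z ∈ H) → (∀ z ∈ ends' e, z ∈ H)) :
    MH ends H ω = MH ends' H ω' :=
  KH_eq_of_agree_off h.compl hH

/-- **The separation from `H` does not see the edges inside `H`.** -/
lemma sepH_iff_of_agree_off {ends ends' : E → Sym2 V} {H : Set V} {ω ω' : Config E}
    (h : AgreeOff ends ends' H ω ω')
    (hH : ∀ e, (∀ z ∈ ends e, z ∈ H) → (∀ z ∈ ends' e, z ∈ H)) (p q : V) :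
    sepH ends p q H ω ↔ sepH ends' p q H ω' := by
  simp only [sepH, KH_eq_of_agree_off h hH, MH_eq_of_agree_off h hH]

/-- **`DZero_H` does not see the edges inside `H`.** -/
lemma DZeroH_iff_of_agree_off {ends ends' : E → Sym2 V} {H : Set V} {ω ω' : Config E}
    (h : AgreeOff ends ends' H ω ω')
    (hH : ∀ e, (∀ z ∈ ends e, z ∈ H) → (∀ z ∈ ends' e, z ∈ H)) :
    DZeroH ends H ω ↔ DZeroH ends' H ω' := by
  simp only [DZeroH, KH_eq_of_agree_off h hH, MH_eq_of_agree_off h hH]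

/-- **A connection from a vertex outside the `Y`-world of `H` does not see the edges inside
`H`** (one direction; only the target `q` needs to be outside the world). -/
lemma conn_of_agree_off_of_not_mem_KH {ends ends' : E → Sym2 V} {H : Set V} {ω ω' : Config E}
    (h : AgreeOff ends ends' H ω ω') {p q : V} (hq : q ∉ KH ends H ω)
    (hc : Conn ends ω p q) : Conn ends' ω' p q := by
  have key : q ∈ {w | w ∈ KH ends H ω ∨ Conn ends' ω' p w} := by
    refine mem_of_conn_of_closed (S := {w | w ∈ KH ends H ω ∨ Conn ends' ω' p w}) ?_
      (Or.inr (conn_refl _ _ _)) hc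
    intro w₁ hw₁ w₂ hw
    obtain ⟨_, e, he, hends⟩ := openGraph_adj.1 hw
    rcases hw₁ with hw₁ | hw₁
    · exact Or.inl (mem_KH_of_open hw₁ he hends)
    · rcases h e with h1 | ⟨h1, h2⟩
      · -- an edge inside `H` has `w₂ ∈ H ⊆ K_H`
        exact Or.inl (mem_KH_of_mem (h1 w₂ (by rw [hends]; exact Sym2.mem_mk_right _ _)) ω)
      · exact Or.inr (conn_trans hw₁ (conn_of_openAdj ⟨e, by rw [h2]; exact he, by rw [h1, hends]⟩))
  rcases key with hq' | hq'
  · exact absurd hq' hq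
  · exact hq'

/-- **The `p`–`q` connection of a colouring separated from `H` does not see the edges inside
`H`.** -/
lemma conn_pq_iff_of_agree_off {ends ends' : E → Sym2 V} {H : Set V} {ω ω' : Config E}
    (h : AgreeOff ends ends' H ω ω')
    (hH : ∀ e, (∀ z ∈ ends e, z ∈ H) → (∀ z ∈ ends' e, z ∈ H)) {p q : V}
    (hq : q ∉ KH ends H ω) :
    Conn ends ω p q ↔ Conn ends' ω' p q := by
  refine ⟨conn_of_agree_off_of_not_mem_KH h hq, ?_⟩
  have hK := KH_eq_of_agree_off h hH
  rw [hK] at hq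
  exact conn_of_agree_off_of_not_mem_KH (h.symm hH) hq

/-- **`σ_pq` of a colouring separated from `H` does not see the edges inside `H`.** -/
lemma sigma_pq_eq_of_agree_off [Fintype E] [DecidableEq E] {ends ends' : E → Sym2 V} {H : Set V}
    {ω ω' : Config E} (h : AgreeOff ends ends' H ω ω')
    (hH : ∀ e, (∀ z ∈ ends e, z ∈ H) → (∀ z ∈ ends' e, z ∈ H)) {p q : V}
    (hsep : sepH ends p q H ω) : sigma ends ω p q = sigma ends' ω' p q := by
  obtain ⟨_, hqK, _, hqM⟩ := hsep
  have e1 := conn_pq_iff_of_agree_off h hH (p := p) hqK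
  have e2 := conn_pq_iff_of_agree_off h.compl hH (p := p) hqM
  simp only [sigma, e1, e2]

end Terminal

end NoPocket

end Summit.Ventures.PercRepro2
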